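/-
Copyright (c) 2026 the pub-hodgecm-mathlib formalisation cell (harness21).  Prover seat hodgecm-mathlib-LH6-p01 (g8): P6b wave C, row Dβ
(Dβ-thm steps (N)(F): the rigidity principles on `Z′ ×_S (A ×_S T)`) (desk F0P6b-plan (g14)); boxes LA-ref2 (g7) ∕ F0P6-ref1 (g9), 2026-09-03.
-/
import Literature.AlgebraicGeometry.AbelianSchemes.RigidifiedIsoNormalize
import Literature.AlgebraicGeometry.AbelianSchemes.AbelianSchemeBaseChangeComp
import Literature.AlgebraicGeometry.Modules.SchemeLinearisation
import HarnessLib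

/-!
# Rigidity of isomorphisms of line bundles on `Z′ ×_S (A ×_S T)` along the slice `Z′ ×_S ({0} ×_S T)`, for an abelian scheme `A/S`

Layer `Literature/AlgebraicGeometry/AbelianSchemes`, namespace `Literature.AlgebraicGeometry.AbelianSchemes.AbelianSchemeOver`.  THEOREMS ONLY (no
definition, no named fact, no instance, no notation, no `sorry`).  Cell `pub/hodgecm-mathlib` (D-0151), P6b wave C, row Dβ, steps (N)(F) of (Dβ-thm)
(desk F0P6b-plan (g14)); organ capital for §D `stub_L4B1uD_mumfordLambdaDescent` (lane `--supports stmt-HodgeConjecture-24832`); count-neutral.  HC_CM is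
proved only modulo the printed citations (2 remaining named inputs hLiu418 = `stmt-HodgeConjecture-24832`, h413 = `stmt-HodgeConjecture-24833`) until
rung 0 closes; nothing here is about HC.

THE PRINT.  [MumfordAV1970] §13, proof of the Theorem p. 125: «normalised isomorphisms are unique» (an isomorphism of line bundles on `X × T` is determined
by its restriction along `{0} × T`, because `p_* 𝒪_{X × T} = 𝒪_T`) and «can be normalised».  The tree has this for the base change `A_T → T` of an abelian
scheme over a locally Noetherian `S` (★ `RigidifiedIsoNormalize`: `iso_baseChange_eq_of_pullback_unitSection_map_eq`,
`exists_iso_pullback_unitSection_map_comp_eq`).  THIS FILE transports both statements to the shape in which a group SCHEME `Z′` acting on the second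
factor of `A ×_S T` meets them: the scheme `Z′ ×_S (A ×_S T)` (Mathlib's left-bracketed products `Z′ ⊗ (A.X ⊗ T)` of the cartesian-monoidal `Over S`),
which is the base change `A_{Z′ ×_S T}` only after the SHUFFLE `(z, (x, t)) ↦ (x, (z, t))`, with the slice `Z′ ◁ (ε_A × 1_T) : Z′ ×_S T → Z′ ×_S (A ×_S T)`
playing the unit section.

* §0 two more coherences of the inverse-image pseudofunctor in the currency of ★ `Modules/SchemeLinearisation` §1b (`compThreeIso`):
  `mapIso_squareIso_eq_compThreeIso` (any square, not only over a common base map) and `mapIso_sectionPullbackIso_eq_compThreeIso`;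
* §1 the frame: `unitSection_baseChange_eq_whiskerRight_left` (the unit section of `A_T` is `(λ⁻¹ ≫ η ▷ T).left`), the shuffle and its two identities;
* §2 **`iso_eq_of_pullback_whiskerLeft_unitSlice_map_eq`** — two isomorphisms of rank-one modules on `Z′ ×_S (A ×_S T)` with the same restriction along
  `Z′ ◁ (ε × 1)` are EQUAL (`S` locally Noetherian; any `Z′`, `T`);
* §3 **`exists_iso_pullback_whiskerLeft_unitSlice_mapIso_eq`** — NORMALISATION: if `M ≅ N` at all and `N` is trivial along the slice, every isomorphism of
  the restrictions `ν : (Z′ ◁ (ε × 1))^* M ≅ (Z′ ◁ (ε × 1))^* N` is the restriction of an isomorphism `M ≅ N` (unique by §2).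
These are the two inputs of the rigid descent of a `Z`-linearisation along `{0} × T` (★ constant-group twin: `RigidDescentAlongUnitSectionOfBaseChange`).

## References
* [MumfordAV1970] D. Mumford, *Abelian Varieties* (1970), §13 (Thm. p. 125 and its proof: normalised isomorphisms), §5 Cor. 6 (p. 54).
* [MumfordFogartyKirwan1994] D. Mumford, J. Fogarty, F. Kirwan, *GIT* 3rd ed. (1994), Ch. 1 §3 Def. 1.6 (p. 30); Ch. 6 §2 (p. 121).
* [GortzWedhorn2023] U. Görtz, T. Wedhorn, *Algebraic Geometry II* (2023), Cor. 24.63 (p. 404), Lemma 24.67 (p. 406).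
-/

set_option autoImplicit false

noncomputable section

-- `Scheme.Modules` / `SheafOfModules` are not reducible; `(A.X ⊗ T).left = (A.baseChange T.hom).X.left` holds by `rfl` only.
set_option backward.isDefEq.respectTransparency false

universe u

open CategoryTheory CategoryTheory.Limits AlgebraicGeometry MonoidalCategory CartesianMonoidalCategory
open scoped MonObj

namespace Literature.AlgebraicGeometry.Modules

/-! ## §0 Two more coherences of `Scheme.Modules.pullback` in the `compThreeIso` currency -/

section Coherence

variable {P Y Y' P' S : Scheme.{u}}

/-- **`x^*` of `pullbackId`** is `x^* 𝟙^* F ≅ (x ≫ 𝟙)^* F = x^* F` (Mathlib `pseudofunctor_left_unitality`, pointwise).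
[cite: MumfordFogartyKirwan1994, Ch. 1 §3 Def. 1.6 (p. 30)] -/
theorem map_pullbackId_hom_app (x : P ⟶ Y) (F : Y.Modules) :
    (Scheme.Modules.pullback x).map ((Scheme.Modules.pullbackId Y).hom.app F) =
      (Scheme.Modules.pullbackComp x (𝟙 Y)).hom.app F ≫ (Scheme.Modules.pullbackCongr (Category.comp_id x)).hom.app F := by
  have h3 := NatTrans.congr_app (Scheme.Modules.pseudofunctor_left_unitality x) F
  simp only [NatTrans.comp_app, Functor.whiskerRight_app, Functor.leftUnitor_hom_app, eqToHom_app, Functor.id_obj] at h3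
  rw [← cancel_epi ((Scheme.Modules.pullbackComp x (𝟙 Y)).inv.app F), Iso.inv_hom_id_app_assoc]
  erw [h3]
  simp [Scheme.Modules.pullbackCongr]

/-- **`x^*` of ANY ★ `squareIso` (of `b ≫ j = j' ≫ a`, at `F`) is `compThreeIso x b j ≪≫ (compThreeIso x j' a)⁻¹`** (generalises ★ `mapIso_squareIso_eq`,
where the two right legs coincide). [cite: MumfordFogartyKirwan1994, Ch. 1 §3 Def. 1.6 (p. 30)] -/
theorem mapIso_squareIso_eq_compThreeIso (x : P ⟶ Y) {b : Y ⟶ Y'} {j : Y' ⟶ S} {Y'' : Scheme.{u}} {j' : Y ⟶ Y''} {a : Y'' ⟶ S}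
    (hsq : b ≫ j = j' ≫ a) {ρ : P ⟶ S} (H₁ : (x ≫ b) ≫ j = ρ) (H₂ : (x ≫ j') ≫ a = ρ) (F : S.Modules) :
    (Scheme.Modules.pullback x).mapIso (RelativeSpec.squareIso hsq F) = compThreeIso x b j H₁ F ≪≫ (compThreeIso x j' a H₂ F).symm := by
  have h₁ : x ≫ b ≫ j = ρ := by rw [← Category.assoc]; exact H₁
  have h₂ : x ≫ j' ≫ a = ρ := by rw [← Category.assoc]; exact H₂
  rw [compThreeIso_eq x b j H₁ h₁ F, compThreeIso_eq x j' a H₂ h₂ F]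
  ext : 1
  simp only [RelativeSpec.squareIso, Functor.mapIso_hom, Iso.trans_hom, Iso.app_hom, Iso.symm_hom, Iso.app_inv, Iso.trans_inv,
    Functor.mapIso_inv, Functor.map_comp, Category.assoc]
  rw [map_pullbackCongr_hom_app x hsq F, pullbackCongr_inv_app h₂ F]
  simp only [Category.assoc]
  rw [pullbackCongr_hom_app_comp_assoc]

/-- **`x^*` of `sectionPullbackIso` is a `compThreeIso`**: `x^*(u^* a^* F ≅ F) = (x^* u^* a^* F ≅ x^* F)` for `u ≫ a = 𝟙`.
[cite: MumfordFogartyKirwan1994, Ch. 1 §3 Def. 1.6 (p. 30)] -/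
theorem mapIso_sectionPullbackIso_eq_compThreeIso (x : P ⟶ Y) {u : Y ⟶ Y'} {a : Y' ⟶ Y} (h : u ≫ a = 𝟙 Y) (H : (x ≫ u) ≫ a = x) (F : Y.Modules) :
    (Scheme.Modules.pullback x).mapIso (sectionPullbackIso h F) = compThreeIso x u a H F := by
  have h' : x ≫ u ≫ a = x := by rw [← Category.assoc]; exact H
  rw [compThreeIso_eq x u a H h' F]
  ext : 1
  simp only [sectionPullbackIso, Functor.mapIso_hom, Iso.trans_hom, Iso.app_hom, Functor.map_comp, map_pullbackCongr_hom_app x h F,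
    map_pullbackId_hom_app, Category.assoc, Iso.inv_hom_id_app_assoc]
  rw [pullbackCongr_hom_app_comp]

/-- **`u^* θ^* ψ = can ≫ ε^* ψ ≫ can⁻¹` for `u ≫ θ = ε`** (naturality of `pullbackComp`∕`pullbackCongr` in the module).
[cite: MumfordFogartyKirwan1994, Ch. 1 §3 Def. 1.6 (p. 30)] -/
theorem map_map_eq_of_comp_eq {P₁ P₂ P₃ : Scheme.{u}} (u : P₁ ⟶ P₂) (θ : P₂ ⟶ P₃) {ε : P₁ ⟶ P₃} (hε : u ≫ θ = ε) {X Y : P₃.Modules}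
    (ψ : X ⟶ Y) :
    (Scheme.Modules.pullback u).map ((Scheme.Modules.pullback θ).map ψ) =
      ((Scheme.Modules.pullbackComp u θ).hom.app X ≫ (Scheme.Modules.pullbackCongr hε).hom.app X) ≫
        (Scheme.Modules.pullback ε).map ψ ≫
          ((Scheme.Modules.pullbackCongr hε).inv.app Y ≫ (Scheme.Modules.pullbackComp u θ).inv.app Y) := by
  have n₁ := (Scheme.Modules.pullbackComp u θ).hom.naturality ψ
  have n₂ := (Scheme.Modules.pullbackCongr hε).hom.naturality ψ
  simp only [Functor.comp_map] at n₁
  simp only [Category.assoc]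
  rw [← reassoc_of% n₂, ← reassoc_of% n₁, Iso.hom_inv_id_app_assoc, Iso.hom_inv_id_app, Category.comp_id]

end Coherence

end Literature.AlgebraicGeometry.Modules

namespace Literature.AlgebraicGeometry.AbelianSchemes

open Literature.AlgebraicGeometry.Modules Literature.AlgebraicGeometry.Motives Literature.AlgebraicGeometry.AbelianVarieties
  Literature.AlgebraicGeometry.RelativeSpec

namespace AbelianSchemeOver

variable {S : Scheme.{u}} (A : AbelianSchemeOver S)

/-! ## §1 The frame: the unit section of `A_T`, the shuffle `Z′ ×_S (A ×_S T) ≅ A ×_S (Z′ ×_S T)` and the slice -/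

/-- **The unit section of the base change `A_T → T` is `(T ≅ 𝟙 ×_S T) ≫ (ε × 1_T)`** (`(λ_ T)⁻¹ ≫ η ▷ T` in `Over S`), on underlying schemes
(both are `(T → S ≫ ε_A, 𝟙_T)`: ★ `unitSection_baseChange_comp_fst`, `unitSection_comp_hom`). [cite: MumfordFogartyKirwan1994, Ch. 6 §2 (p. 121)] -/
theorem unitSection_baseChange_eq_whiskerRight_left (T : Over S) :
    (A.baseChange T.hom).unitSection = ((λ_ T).inv ≫ η[A.X] ▷ T).left := by
  apply pullback.hom_ext
  · rw [unitSection_baseChange_comp_fst, Over.comp_left, Category.assoc]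
    erw [Over.whiskerRight_left_fst]
    rw [← Category.assoc]
    erw [Over.leftUnitor_inv_left_fst]
  · have h := (A.baseChange T.hom).unitSection_comp_hom
    rw [baseChange_hom] at h
    rw [h, Over.comp_left, Category.assoc]
    erw [Over.whiskerRight_left_snd, Over.leftUnitor_inv_left_snd]

/-- ★ `iso_baseChange_eq_of_pullback_unitSection_map_eq` («rigidified isomorphisms of line bundles on `A_W` are unique») read on Mathlib's product
`A.X ⊗ W` with the unit section spelled `(λ⁻¹ ≫ η ▷ W).left`. [cite: MumfordAV1970, §13 (p. 125)] -/
theorem iso_tensor_eq_of_pullback_unitSlice_map_eq [IsLocallyNoetherian S] (W : Over S) {E E' : (A.X ⊗ W).left.Modules} (h₁ : HasRank E 1)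
    (α β : E ≅ E') (h : (Scheme.Modules.pullback ((λ_ W).inv ≫ η[A.X] ▷ W).left).map α.hom =
      (Scheme.Modules.pullback ((λ_ W).inv ≫ η[A.X] ▷ W).left).map β.hom) : α = β := by
  rw [← A.unitSection_baseChange_eq_whiskerRight_left W] at h
  exact A.iso_baseChange_eq_of_pullback_unitSection_map_eq W.hom h₁ α β h

/-- ★ `exists_iso_pullback_unitSection_map_comp_eq` (NORMALISATION of an isomorphism of rigidified line bundles on `A_W`) read on Mathlib's product `A.X ⊗ W`
with the unit section spelled `(λ⁻¹ ≫ η ▷ W).left`. [cite: MumfordAV1970, §13 (p. 125)] -/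
theorem exists_iso_tensor_pullback_unitSlice_map_comp_eq (W : Over S) {E₁ E₂ : (A.X ⊗ W).left.Modules}
    (r₁ : (Scheme.Modules.pullback ((λ_ W).inv ≫ η[A.X] ▷ W).left).obj E₁ ≅ SheafOfModules.unit _)
    (r₂ : (Scheme.Modules.pullback ((λ_ W).inv ≫ η[A.X] ▷ W).left).obj E₂ ≅ SheafOfModules.unit _) (α : E₁ ≅ E₂) :
    ∃ φ : E₁ ≅ E₂, (Scheme.Modules.pullback ((λ_ W).inv ≫ η[A.X] ▷ W).left).map φ.hom ≫ r₂.hom = r₁.hom := by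
  revert r₁ r₂
  rw [← A.unitSection_baseChange_eq_whiskerRight_left W]
  intro r₁ r₂
  exact A.exists_iso_pullback_unitSection_map_comp_eq W.hom r₁ r₂ α

/-- The shuffle `(z, (x, t)) ↦ (x, (z, t))` and the un-shuffle `(x, (z, t)) ↦ (z, (x, t))` are mutually inverse (one direction).
[cite: MumfordFogartyKirwan1994, Ch. 1 §3 Def. 1.6 (p. 30)] -/
theorem shuffle_comp_unshuffle (Z' T : Over S) :
    lift (snd Z' (A.X ⊗ T) ≫ fst A.X T) (lift (fst Z' (A.X ⊗ T)) (snd Z' (A.X ⊗ T) ≫ snd A.X T)) ≫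
        lift (snd A.X (Z' ⊗ T) ≫ fst Z' T) (lift (fst A.X (Z' ⊗ T)) (snd A.X (Z' ⊗ T) ≫ snd Z' T)) = 𝟙 (Z' ⊗ (A.X ⊗ T)) := by
  ext <;> simp

/-- The other direction. [cite: MumfordFogartyKirwan1994, Ch. 1 §3 Def. 1.6 (p. 30)] -/
theorem unshuffle_comp_shuffle (Z' T : Over S) :
    lift (snd A.X (Z' ⊗ T) ≫ fst Z' T) (lift (fst A.X (Z' ⊗ T)) (snd A.X (Z' ⊗ T) ≫ snd Z' T)) ≫
        lift (snd Z' (A.X ⊗ T) ≫ fst A.X T) (lift (fst Z' (A.X ⊗ T)) (snd Z' (A.X ⊗ T) ≫ snd A.X T)) = 𝟙 (A.X ⊗ (Z' ⊗ T)) := by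
  ext <;> simp

/-- **The slice `Z′ ◁ (ε × 1_T)` followed by the shuffle is the unit slice `ε × 1_{Z′ ×_S T}` of `A ×_S (Z′ ×_S T)`** (on points
`(z, t) ↦ (z, (0, t)) ↦ (0, (z, t))`). [cite: MumfordFogartyKirwan1994, Ch. 6 §2 (p. 121)] -/
theorem whiskerLeft_unitSlice_comp_shuffle (Z' T : Over S) :
    (Z' ◁ ((λ_ T).inv ≫ η[A.X] ▷ T)) ≫ lift (snd Z' (A.X ⊗ T) ≫ fst A.X T) (lift (fst Z' (A.X ⊗ T)) (snd Z' (A.X ⊗ T) ≫ snd A.X T)) =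
      (λ_ (Z' ⊗ T)).inv ≫ η[A.X] ▷ (Z' ⊗ T) := by
  ext <;> simp

/-! ## §2 Rigidity and normalisation through an abstract frame `Q ≅ A ×_S W` -/

section Frame

variable (W : Over S) {Q : Scheme.{u}} (θ : Q ⟶ (A.X ⊗ W).left) (θ' : (A.X ⊗ W).left ⟶ Q) (u : W.left ⟶ Q)

/-- **`u^*` of the `sectionPullbackIso` of the frame is the canonical comparison `u^* θ^* θ'^* X ≅ ε^* θ'^* X ≅ u^* X`** (`u ≫ θ = ε`, `ε ≫ θ' = u`; pseudofunctor
coherence, §0). [cite: MumfordAV1970, §13 (p. 125)] -/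
theorem pullback_mapIso_sectionPullbackIso_of_frame (h1 : θ ≫ θ' = 𝟙 Q) {ε : W.left ⟶ (A.X ⊗ W).left} (hε : u ≫ θ = ε) (hεθ : ε ≫ θ' = u)
    (X : Q.Modules) :
    (Scheme.Modules.pullback u).mapIso (sectionPullbackIso h1 X) =
      ((Scheme.Modules.pullbackComp u θ).app _ ≪≫ (Scheme.Modules.pullbackCongr hε).app _) ≪≫
        ((Scheme.Modules.pullbackComp ε θ').app X ≪≫ (Scheme.Modules.pullbackCongr hεθ).app X) := by
  have H : (u ≫ θ) ≫ θ' = u := by rw [Category.assoc, h1, Category.comp_id]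
  rw [mapIso_sectionPullbackIso_eq_compThreeIso u h1 H X]
  ext : 1
  simp only [compThreeIso, Iso.trans_hom, Iso.app_hom, Category.assoc]
  rw [pullbackCongr_hom_app_comp_pullbackComp_hom_app_assoc hε θ' X, pullbackCongr_hom_app_comp]

/-- **RIGIDITY THROUGH A FRAME**: if `Q ≅ A ×_S W` by `θ`∕`θ'` (`θ ≫ θ' = 𝟙`) and `u : W → Q` becomes the unit slice `ε × 1_W` (`(ε × 1) ≫ θ' = u`), then two isomorphisms
of modules on `Q`, the source of rank one, with the same restriction along `u` are EQUAL (★ `iso_baseChange_eq_of_pullback_unitSection_map_eq` on `A_W`, transported).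
[cite: MumfordAV1970, §13 (p. 125)] [cite: GortzWedhorn2023, Lemma 24.67 (p. 406)] -/
theorem iso_eq_of_pullback_map_eq_of_frame [IsLocallyNoetherian S] (h1 : θ ≫ θ' = 𝟙 Q) (hεθ : ((λ_ W).inv ≫ η[A.X] ▷ W).left ≫ θ' = u)
    {M N : Q.Modules} (hM : HasRank M 1) (α β : M ≅ N)
    (h : (Scheme.Modules.pullback u).map α.hom = (Scheme.Modules.pullback u).map β.hom) : α = β := by
  -- on `A ×_S W`: the transported isomorphisms agree along the unit slice
  have key : (Scheme.Modules.pullback θ').mapIso α = (Scheme.Modules.pullback θ').mapIso β := by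
    refine A.iso_tensor_eq_of_pullback_unitSlice_map_eq W (hasRank_pullback _ hM) _ _ ?_
    rw [Functor.mapIso_hom, Functor.mapIso_hom, map_map_eq_of_comp_eq _ θ' hεθ α.hom,
      map_map_eq_of_comp_eq _ θ' hεθ β.hom, h]
  -- back along `θ`
  have key' : (Scheme.Modules.pullback θ).map ((Scheme.Modules.pullback θ').map α.hom) =
      (Scheme.Modules.pullback θ).map ((Scheme.Modules.pullback θ').map β.hom) := by
    have e := congrArg Iso.hom key
    simp only [Functor.mapIso_hom] at e
    rw [e]
  ext : 1
  rw [← cancel_epi (sectionPullbackIso h1 M).hom, ← sectionPullbackIso_hom_naturality h1 α.hom,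
    ← sectionPullbackIso_hom_naturality h1 β.hom, key']

/-- **NORMALISATION THROUGH A FRAME**: with `θ`, `θ'`, `u` as above (`θ ≫ θ' = 𝟙`, `u ≫ θ = ε × 1_W`, `(ε × 1_W) ≫ θ' = u`), modules `M ≅ N` on `Q` and a
trivialisation `r` of `u^* N`, every isomorphism `ν : u^* M ≅ u^* N` is the restriction of an isomorphism `φ : M ≅ N` (★ `exists_iso_pullback_unitSection_map_comp_eq` on
`A_W`, transported; unique by the previous theorem when `M` has rank one). [cite: MumfordAV1970, §13 (p. 125)] [cite: GortzWedhorn2023, Lemma 24.67 (p. 406)] -/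
theorem exists_iso_pullback_mapIso_eq_of_frame (h1 : θ ≫ θ' = 𝟙 Q) (hε : u ≫ θ = ((λ_ W).inv ≫ η[A.X] ▷ W).left)
    (hεθ : ((λ_ W).inv ≫ η[A.X] ▷ W).left ≫ θ' = u) {M N : Q.Modules} (hMN : Nonempty (M ≅ N))
    (r : (Scheme.Modules.pullback u).obj N ≅ SheafOfModules.unit _)
    (ν : (Scheme.Modules.pullback u).obj M ≅ (Scheme.Modules.pullback u).obj N) :
    ∃ φ : M ≅ N, (Scheme.Modules.pullback u).mapIso φ = ν := by
  -- normalise on `A ×_S W`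
  obtain ⟨φ', hφ'⟩ := A.exists_iso_tensor_pullback_unitSlice_map_comp_eq W (E₁ := (Scheme.Modules.pullback θ').obj M)
    (E₂ := (Scheme.Modules.pullback θ').obj N)
    (((Scheme.Modules.pullbackComp _ θ').app M ≪≫ (Scheme.Modules.pullbackCongr hεθ).app M) ≪≫ ν ≪≫ r)
    (((Scheme.Modules.pullbackComp _ θ').app N ≪≫ (Scheme.Modules.pullbackCongr hεθ).app N) ≪≫ r)
    ((Scheme.Modules.pullback θ').mapIso hMN.some)
  -- `ε^* φ' = C_M ≫ ν ≫ C_N⁻¹`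
  have hφ'' : (Scheme.Modules.pullback ((λ_ W).inv ≫ η[A.X] ▷ W).left).mapIso φ' =
      ((Scheme.Modules.pullbackComp _ θ').app M ≪≫ (Scheme.Modules.pullbackCongr hεθ).app M) ≪≫ ν ≪≫
        ((Scheme.Modules.pullbackComp _ θ').app N ≪≫ (Scheme.Modules.pullbackCongr hεθ).app N).symm := by
    ext : 1
    have e := (Iso.eq_comp_inv _).mpr hφ'
    simpa only [Functor.mapIso_hom, Iso.trans_hom, Iso.trans_inv, Iso.symm_hom, Category.assoc, Iso.hom_inv_id_assoc] using e
  -- `u^* θ^* φ' = D ≫ ε^* φ' ≫ D⁻¹`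
  have hD : (Scheme.Modules.pullback u).mapIso ((Scheme.Modules.pullback θ).mapIso φ') =
      ((Scheme.Modules.pullbackComp u θ).app _ ≪≫ (Scheme.Modules.pullbackCongr hε).app _) ≪≫
        (Scheme.Modules.pullback ((λ_ W).inv ≫ η[A.X] ▷ W).left).mapIso φ' ≪≫
        ((Scheme.Modules.pullbackComp u θ).app _ ≪≫ (Scheme.Modules.pullbackCongr hε).app _).symm := by
    ext : 1
    simpa only [Functor.mapIso_hom, Iso.trans_hom, Iso.symm_hom, Iso.trans_inv, Iso.app_hom, Iso.app_inv, Category.assoc] using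
      map_map_eq_of_comp_eq u θ hε φ'.hom
  refine ⟨(sectionPullbackIso h1 M).symm ≪≫ (Scheme.Modules.pullback θ).mapIso φ' ≪≫ sectionPullbackIso h1 N, ?_⟩
  rw [Functor.mapIso_trans, Functor.mapIso_trans, Functor.mapIso_symm, hD, hφ'',
    A.pullback_mapIso_sectionPullbackIso_of_frame W θ θ' u h1 hε hεθ M, A.pullback_mapIso_sectionPullbackIso_of_frame W θ θ' u h1 hε hεθ N]
  ext : 1
  simp

end Frame

/-! ## §3 The slice `Z′ ◁ (ε × 1_T)` of `Z′ ×_S (A ×_S T)` -/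

section Slice

variable [IsLocallyNoetherian S] (Z' T : Over S)

/-- **RIGIDITY ALONG THE SLICE**: two isomorphisms `α β : M ≅ N` of modules on `Z′ ×_S (A ×_S T)`, `M` of rank one, with the same restriction along the slice
`Z′ ◁ (ε × 1_T) : Z′ ×_S T → Z′ ×_S (A ×_S T)` are EQUAL (`S` locally Noetherian; `Z′`, `T` arbitrary): §2 through the shuffle frame of §1.
[cite: MumfordAV1970, §13 (p. 125)] [cite: GortzWedhorn2023, Lemma 24.67 (p. 406)] -/
theorem iso_eq_of_pullback_whiskerLeft_unitSlice_map_eq {M N : (Z' ⊗ (A.X ⊗ T)).left.Modules} (hM : HasRank M 1) (α β : M ≅ N)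
    (h : (Scheme.Modules.pullback (Z' ◁ ((λ_ T).inv ≫ η[A.X] ▷ T)).left).map α.hom =
      (Scheme.Modules.pullback (Z' ◁ ((λ_ T).inv ≫ η[A.X] ▷ T)).left).map β.hom) : α = β := by
  have h1 := congrArg Over.Hom.left (A.shuffle_comp_unshuffle Z' T)
  rw [Over.comp_left, Over.id_left] at h1
  have hεθ : ((λ_ (Z' ⊗ T)).inv ≫ η[A.X] ▷ (Z' ⊗ T)).left ≫
      (lift (snd A.X (Z' ⊗ T) ≫ fst Z' T) (lift (fst A.X (Z' ⊗ T)) (snd A.X (Z' ⊗ T) ≫ snd Z' T))).left =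
      (Z' ◁ ((λ_ T).inv ≫ η[A.X] ▷ T)).left := by
    rw [← A.whiskerLeft_unitSlice_comp_shuffle Z' T, Over.comp_left, Category.assoc, ← Over.comp_left, A.shuffle_comp_unshuffle Z' T,
      Over.id_left, Category.comp_id]
  exact A.iso_eq_of_pullback_map_eq_of_frame (Z' ⊗ T) _ _ _ h1 hεθ hM α β h

omit [IsLocallyNoetherian S] in
/-- **NORMALISATION ALONG THE SLICE**: for modules `M N` on `Z′ ×_S (A ×_S T)` with `M ≅ N` and a trivialisation `r` of `N` along the slice `Z′ ◁ (ε × 1_T)`,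
every isomorphism `ν` of the restrictions along the slice is the restriction of an isomorphism `φ : M ≅ N` (§2 through the shuffle frame; unique by the previous
theorem when `M` has rank one). [cite: MumfordAV1970, §13 (p. 125)] [cite: GortzWedhorn2023, Lemma 24.67 (p. 406)] -/
theorem exists_iso_pullback_whiskerLeft_unitSlice_mapIso_eq {M N : (Z' ⊗ (A.X ⊗ T)).left.Modules} (hMN : Nonempty (M ≅ N))
    (r : (Scheme.Modules.pullback (Z' ◁ ((λ_ T).inv ≫ η[A.X] ▷ T)).left).obj N ≅ SheafOfModules.unit _)
    (ν : (Scheme.Modules.pullback (Z' ◁ ((λ_ T).inv ≫ η[A.X] ▷ T)).left).obj M ≅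
      (Scheme.Modules.pullback (Z' ◁ ((λ_ T).inv ≫ η[A.X] ▷ T)).left).obj N) :
    ∃ φ : M ≅ N, (Scheme.Modules.pullback (Z' ◁ ((λ_ T).inv ≫ η[A.X] ▷ T)).left).mapIso φ = ν := by
  have h1 := congrArg Over.Hom.left (A.shuffle_comp_unshuffle Z' T)
  rw [Over.comp_left, Over.id_left] at h1
  have hε : (Z' ◁ ((λ_ T).inv ≫ η[A.X] ▷ T)).left ≫
      (lift (snd Z' (A.X ⊗ T) ≫ fst A.X T) (lift (fst Z' (A.X ⊗ T)) (snd Z' (A.X ⊗ T) ≫ snd A.X T))).left =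
      ((λ_ (Z' ⊗ T)).inv ≫ η[A.X] ▷ (Z' ⊗ T)).left := by
    rw [← Over.comp_left, A.whiskerLeft_unitSlice_comp_shuffle Z' T]
  have hεθ : ((λ_ (Z' ⊗ T)).inv ≫ η[A.X] ▷ (Z' ⊗ T)).left ≫
      (lift (snd A.X (Z' ⊗ T) ≫ fst Z' T) (lift (fst A.X (Z' ⊗ T)) (snd A.X (Z' ⊗ T) ≫ snd Z' T))).left =
      (Z' ◁ ((λ_ T).inv ≫ η[A.X] ▷ T)).left := by
    rw [← hε, Category.assoc, ← Over.comp_left, A.shuffle_comp_unshuffle Z' T, Over.id_left, Category.comp_id]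
  exact A.exists_iso_pullback_mapIso_eq_of_frame (Z' ⊗ T) _ _ _ h1 hε hεθ hMN r ν

end Slice

end AbelianSchemeOver

end Literature.AlgebraicGeometry.AbelianSchemes

end
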